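import Literature.Computability.AlgebraicComplexity.BD17DescartesSystemsWronskians
import HarnessLib

/-!
# Bihan–Dickenstein 2017: proved companions (Cor. 3.1 ⇐ Thm. 2.9; Cor. 3.4 ⇐ Thm. 3.3; Lemma 4.4)

F. Bihan, A. Dickenstein, *Descartes' rule of signs for polynomial systems supported on circuits*,
Int. Math. Res. Not. IMRN 2017 (22) 6867–6893 = arXiv:1601.05826 [BihanDickenstein2017]. THEOREMS
ONLY; sibling of the statement file `BD17DescartesCircuits.lean` (cell `val-lit`, row X4-BD17),
whose named facts are NOT restated. Contents:

* `signVarAux_le_length_sub_one`, `signVar_le_length_sub_one`: the sign variation of a sequence of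
  length `k` is at most `k − 1` (for the tree's `Literature.Algebra.Polynomial.signVar`, Basu–Pollack–Roy
  Notation 2.32);
* `BD17.length_sAlpha`: `s_α` has length `k = |K|`;
* `BD2017_cor_3_1_of_thm_2_9`: **Cor. 3.1** (`n_A(C) ≤ k − 1`) follows BY NAME from **Thm. 2.9** and
  Prop. 2.6 (existence of an ordering), exactly as printed: "This follows immediately from (2.15),
  since `s_α` is a sequence of length `k` and so its sign variation can be at most equal to `k − 1`"
  (p0009:L15 of the held text `paper:arxiv-1601.05826`).
* `BD2017_lem_4_4_holds : BD2017_lem_4_4` — **Lemma 4.4 DISCHARGED** (p0010:L123 "Lemma 21"): for a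
  sequence `s = (c_0, …, c_{k−1})` with `sgnvar(s) ≠ 0`, `sgnvar(s)` is the minimum over `q ∈ [k]` of
  `s_q = 1 + sgnvar(−c_0, …, −c_{q−1}, c_{q+1}, …, c_{k−1})`. Proof (ours, elementary; the print's
  is a three-line local count): on the subsequence of nonzero entries, negating a prefix and deleting
  one entry changes the sign-change count only at the junction
  (`signVar_le_one_add_signVar_negTake_drop`, by the junction formula for `signVarAux` of a
  concatenation); equality is attained at the position of the FIRST sign change
  (`exists_signVar_eq_one_add_signVar_negTake_drop`, by induction on the list with the invariant
  "all nonzero entries before `q` have the sign of `c_q`, and the transformed sequence starts with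
  the opposite sign").
* `BD2017_cor_3_4_of_thm_3_3 : BD2017_thm_3_3 → BD2017_cor_3_4` — **Cor. 3.4 BY NAME from Thm. 3.3**,
  as printed ("if a configuration `𝒜` consists of the vertices of a simplex plus one interior point
  … its signature equals `{1, n+1}` and so `σ(𝒜) = 1`. Theorem 3.3 ensures that `n_𝒜(C) ≤ 2`",
  p0009:L95–99): `BD17.expMatrix_mulVec_affRel` (the signed maximal minors `λ` form an affine
  relation, eq. (2.1) — Laplace expansion of `A` with a repeated row),
  `BD17.exists_smul_affRel_of_mulVec_eq_zero` ("the kernel of `A` has dimension `1` and can be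
  generated by `λ`", p0004:L30 — rank–nullity under (1.3)), `BD17.exists_affRel_of_interior` (the
  barycentric coordinates of the interior point w.r.t. the simplex are positive — Mathlib's
  `AffineBasis.interior_convexHull` — and give an affine relation with one negative entry),
  `BD17.sigma_le_one_of_interior` (`σ(𝒜) ≤ 1`).

Honest framing: typed-literature companions; nothing here bears on VP versus VNP.

## References

* [BihanDickenstein2017] F. Bihan, A. Dickenstein, IMRN 2017 (22) 6867–6893; arXiv:1601.05826,
  §2.1 eq. (2.1), Cor. 3.1, Cor. 3.4, Lemma 4.4.
* [BasuPollackRoy2006] S. Basu, R. Pollack, M.-F. Roy, *Algorithms in Real Algebraic Geometry*,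
  Notation 2.32.
-/

noncomputable section

open Matrix Finset
open Literature.Algebra.Polynomial (signVar signVarAux)

namespace Literature.Computability.AlgebraicComplexity

section CorThreeOne

/-- The number of sign changes of a list of (nonzero) reals is at most its length minus one.
[cite: BasuPollackRoy2006, Notation 2.32] -/
theorem signVarAux_le_length_sub_one (l : List ℝ) : signVarAux l ≤ l.length - 1 := by
  induction l with
  | nil => simp [signVarAux]
  | cons a l ih =>
    cases l with
    | nil => simp [signVarAux]
    | cons b l =>
      simp only [signVarAux, List.length_cons] at ih ⊢
      split_ifs <;> omega

/-- `Var(c_0, …, c_{k−1}) ≤ k − 1` ("`s_α` is a sequence of length `k` and so its sign variation can be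
at most equal to `k − 1`", proof of Cor. 3.1, p0009:L15). [cite: BihanDickenstein2017, Cor. 3.1 (proof)] -/
theorem signVar_le_length_sub_one (l : List ℝ) : signVar l ≤ l.length - 1 := by
  unfold Literature.Algebra.Polynomial.signVar
  exact (signVarAux_le_length_sub_one _).trans
    (Nat.sub_le_sub_right (List.length_filter_le _ _) 1)

/-- The sequence `s_α = (λ̄_0, …, λ̄_{k−1})` has length `k = |K|`. [cite: BihanDickenstein2017, §2.3 eq. (2.14)] -/
theorem BD17.length_sAlpha {n : ℕ} (w : Fin (n + 2) → Fin n → ℤ)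
    (C : Matrix (Fin n) (Fin (n + 2)) ℝ) (K : Finset (Fin (n + 2)))
    (α : Equiv.Perm (Fin (n + 2))) : (BD17.sAlpha w C K α).length = K.card := by
  simp [BD17.sAlpha]

/-- **BD 2017, Cor. 3.1 follows from Thm. 2.9** (and Prop. 2.6, which supplies an ordering `α` of
`C`): `n_A(C) ≤ sgnvar(s_α) ≤ k − 1`. [cite: BihanDickenstein2017, Cor. 3.1] -/
theorem BD2017_cor_3_1_of_thm_2_9 (h29 : BD2017_thm_2_9) (h26 : BD2017_prop_2_6) :
    BD2017_cor_3_1 := by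
  intro n w C hrk hcone hcirc K hK hfin
  obtain ⟨α, hα⟩ := h26 n C hrk.2 hcone
  have h := (h29 n w C hrk hcone hcirc α hα K hK hfin).1
  have hl := signVar_le_length_sub_one (BD17.sAlpha w C K α)
  rw [BD17.length_sAlpha] at hl
  exact h.trans hl

end CorThreeOne

/-! ### Lemma 4.4 (the sign-variation minimum lemma) — PROVED -/

section LemmaFourFour

/-- The two-term recursion of `signVarAux`. [folklore] -/
private theorem signVarAux_cons_cons (a b : ℝ) (l : List ℝ) :
    signVarAux (a :: b :: l) = (if a * b < 0 then 1 else 0) + signVarAux (b :: l) := by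
  simp [signVarAux]

/-- `signVarAux [a] = 0`. [folklore] -/
private theorem signVarAux_singleton (a : ℝ) : signVarAux [a] = 0 := by simp [signVarAux]

/-- `signVarAux [] = 0`. [folklore] -/
private theorem signVarAux_nil' : signVarAux [] = 0 := by simp [signVarAux]

/-- Junction formula: the sign changes of `A ++ a :: b :: B` are those of `A ++ [a]`, those of
`b :: B`, and possibly one at the junction `(a, b)`. [folklore] -/
private theorem signVarAux_append_cons_cons (A : List ℝ) (a b : ℝ) (B : List ℝ) :
    signVarAux (A ++ a :: b :: B) =
      signVarAux (A ++ [a]) + (if a * b < 0 then 1 else 0) + signVarAux (b :: B) := by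
  induction A with
  | nil => simp [signVarAux_cons_cons, signVarAux_singleton]
  | cons x A ih =>
    cases A with
    | nil =>
      simp only [List.nil_append, List.cons_append, signVarAux_cons_cons, signVarAux_singleton]
      omega
    | cons y A' =>
      simp only [List.cons_append] at ih ⊢
      rw [signVarAux_cons_cons, signVarAux_cons_cons, ih]
      omega

/-- Negating every entry does not change the number of sign changes. [folklore] -/
private theorem signVarAux_map_neg (A : List ℝ) :
    signVarAux (A.map (fun c => -c)) = signVarAux A := by
  induction A with
  | nil => rfl
  | cons a A ih =>
    cases A with
    | nil => simp [signVarAux]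
    | cons b A' =>
      simp only [List.map_cons] at ih ⊢
      rw [signVarAux_cons_cons, signVarAux_cons_cons, ih, neg_mul_neg]

/-- `signVarAux (−A' ++ [−a]) = signVarAux (A' ++ [a])`. [folklore] -/
private theorem signVarAux_map_neg_snoc (A' : List ℝ) (a : ℝ) :
    signVarAux (A'.map (fun c => -c) ++ [-a]) = signVarAux (A' ++ [a]) := by
  have : A'.map (fun c => -c) ++ [-a] = (A' ++ [a]).map (fun c => -c) := by simp
  rw [this, signVarAux_map_neg]

/-- Dropping zeros commutes with negation. [folklore] -/
private theorem filter_ne_zero_map_neg (A : List ℝ) :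
    (A.map (fun c => -c)).filter (fun a => decide (a ≠ 0)) =
      (A.filter (fun a => decide (a ≠ 0))).map (fun c => -c) := by
  rw [List.filter_map]
  congr 1
  apply List.filter_congr
  intro x _
  simp

/-- The nonzero entries of the transformed sequence `(−c_0, …, −c_{q−1}, c_{q+1}, …)`. [folklore] -/
private theorem filter_negTake_drop (l : List ℝ) (q : ℕ) :
    ((l.take q).map (fun c => -c) ++ l.drop (q + 1)).filter (fun a => decide (a ≠ 0)) =
      ((l.take q).filter (fun a => decide (a ≠ 0))).map (fun c => -c) ++
        (l.drop (q + 1)).filter (fun a => decide (a ≠ 0)) := by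
  rw [List.filter_append, filter_ne_zero_map_neg]

/-- The nonzero entries of `l` split around the position `q`. [folklore] -/
private theorem filter_split_at (l : List ℝ) (q : ℕ) (hq : q < l.length) :
    l.filter (fun a => decide (a ≠ 0)) =
      (l.take q).filter (fun a => decide (a ≠ 0)) ++
        (l[q] :: l.drop (q + 1)).filter (fun a => decide (a ≠ 0)) := by
  conv_lhs => rw [← List.take_append_drop q l, List.drop_eq_getElem_cons hq]
  rw [List.filter_append]

/-- Indicator arithmetic at the junction: `[ac < 0] + [cb < 0] ≤ 1 + [(−a)b < 0]`. [folklore] -/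
private theorem ite_junction_le (a b c : ℝ) :
    (if a * c < 0 then 1 else 0) + (if c * b < 0 then 1 else 0) ≤
      1 + (if -a * b < 0 then 1 else 0) := by
  split_ifs with h1 h2 h3 <;> try omega
  exfalso
  have h4 : 0 < a * c * (c * b) := mul_pos_of_neg_of_neg h1 h2
  have h5 : a * b * (c * c) ≤ 0 :=
    mul_nonpos_of_nonpos_of_nonneg (by linarith) (mul_self_nonneg c)
  nlinarith

/-- The inequality `sgnvar(s) ≤ s_q` on the level of the nonzero subsequences `A` (before `q`) and
`B` (after `q`), `c = c_q`. [folklore] -/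
private theorem signVarAux_split_le (A B : List ℝ) (c : ℝ) :
    signVarAux (A ++ if decide (c ≠ 0) then c :: B else B) ≤
      1 + signVarAux (A.map (fun c => -c) ++ B) := by
  split_ifs with h
  · rcases A.eq_nil_or_concat with hA | ⟨A', a, hA⟩
    · subst hA
      cases B with
      | nil => simp [signVarAux_singleton]
      | cons b B' =>
        rw [List.nil_append, List.map_nil, List.nil_append, signVarAux_cons_cons]
        split_ifs <;> omega
    · rw [List.concat_eq_append] at hA
      subst hA
      cases B with
      | nil =>
        rw [List.append_assoc, List.singleton_append, signVarAux_append_cons_cons,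
          signVarAux_singleton, List.append_nil, signVarAux_map_neg]
        split_ifs <;> omega
      | cons b B' =>
        rw [List.append_assoc, List.singleton_append, signVarAux_append_cons_cons,
          signVarAux_cons_cons, List.map_append, List.map_cons, List.map_nil, List.append_assoc,
          List.singleton_append, signVarAux_append_cons_cons, signVarAux_map_neg_snoc]
        have := ite_junction_le a b c
        omega
  · rcases A.eq_nil_or_concat with hA | ⟨A', a, hA⟩
    · subst hA
      simp
    · rw [List.concat_eq_append] at hA
      subst hA
      cases B with
      | nil => rw [List.append_nil, List.append_nil, signVarAux_map_neg]; omega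
      | cons b B' =>
        rw [List.append_assoc, List.singleton_append, signVarAux_append_cons_cons,
          List.map_append, List.map_cons, List.map_nil, List.append_assoc, List.singleton_append,
          signVarAux_append_cons_cons, signVarAux_map_neg_snoc]
        split_ifs <;> omega

/-- **Lemma 4.4, the inequalities `sgnvar(s) ≤ s_q`** for every `q ∈ [k]`
(`s_q = 1 + sgnvar(−c_0, …, −c_{q−1}, c_{q+1}, …, c_{k−1})`; print: "For any `q ∈ [k]`, we easily have
`sgnvar(s) ≤ s_q`"). [cite: BihanDickenstein2017, Lemma 4.4] -/
theorem signVar_le_one_add_signVar_negTake_drop (l : List ℝ) (q : ℕ) (hq : q < l.length) :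
    signVar l ≤ 1 + signVar ((l.take q).map (fun c => -c) ++ l.drop (q + 1)) := by
  unfold Literature.Algebra.Polynomial.signVar
  rw [filter_negTake_drop, filter_split_at l q hq, List.filter_cons]
  exact signVarAux_split_le _ _ _

/-- Plumbing: the transformed sequence for `q = 0` is the tail. [folklore] -/
private theorem negTake_drop_zero_cons (x : ℝ) (l : List ℝ) :
    ((x :: l).take 0).map (fun c => -c) ++ (x :: l).drop (0 + 1) = l := by
  simp

/-- Plumbing: the transformed sequence for `q + 1` on `x :: l` starts with `−x`. [folklore] -/
private theorem negTake_drop_succ_cons (x : ℝ) (l : List ℝ) (q : ℕ) :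
    ((x :: l).take (q + 1)).map (fun c => -c) ++ (x :: l).drop (q + 1 + 1) =
      (-x) :: ((l.take q).map (fun c => -c) ++ l.drop (q + 1)) := by
  simp [List.take_succ_cons, List.drop_succ_cons]

/-- A leading zero is dropped by the nonzero filter. [folklore] -/
private theorem filter_ne_zero_cons_zero (l : List ℝ) :
    ((0 : ℝ) :: l).filter (fun a => decide (a ≠ 0)) = l.filter (fun a => decide (a ≠ 0)) := by
  rw [List.filter_cons_of_neg (by simp)]

/-- A leading nonzero entry is kept by the nonzero filter. [folklore] -/
private theorem filter_ne_zero_cons_of_ne {x : ℝ} (hx : x ≠ 0) (l : List ℝ) :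
    (x :: l).filter (fun a => decide (a ≠ 0)) = x :: l.filter (fun a => decide (a ≠ 0)) := by
  rw [List.filter_cons_of_pos (by simpa using hx)]

/-- `signVar` unfolded. [folklore] -/
private theorem signVar_eq_signVarAux_filter (l : List ℝ) :
    signVar l = signVarAux (l.filter (fun a => decide (a ≠ 0))) := rfl

/-- **Lemma 4.4, the attained minimum** (print: "Assume that the sign variation `sgnvar(s)` is not
the minimum of these quantities `s_q` … It follows that … `sgnvar(s) = 0`"), in the strengthened
form proved by induction on the sequence: there is an index `q` (the first sign change) with
`c_q ≠ 0`, every nonzero entry before `q` of the sign of `c_q`, the transformed sequence starting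
with the opposite sign, and `sgnvar(s) = s_q`. [cite: BihanDickenstein2017, Lemma 4.4] -/
theorem exists_signVar_eq_one_add_signVar_negTake_drop (l : List ℝ) (h : signVar l ≠ 0) :
    ∃ (q : ℕ) (hq : q < l.length), l[q] ≠ 0 ∧
      (∀ y, (l.filter (fun a => decide (a ≠ 0))).head? = some y → 0 < y * l[q]) ∧
      (∀ z, (((l.take q).map (fun c => -c) ++ l.drop (q + 1)).filter
          (fun a => decide (a ≠ 0))).head? = some z → z * l[q] < 0) ∧
      signVar l = 1 + signVar ((l.take q).map (fun c => -c) ++ l.drop (q + 1)) := by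
  induction l with
  | nil => exact absurd rfl h
  | cons x l ih =>
    by_cases hx : x = 0
    · subst hx
      have hV : signVar ((0 : ℝ) :: l) = signVar l := by
        rw [signVar_eq_signVarAux_filter, signVar_eq_signVarAux_filter, filter_ne_zero_cons_zero]
      obtain ⟨q, hq, h1, h2, h3, h4⟩ := ih (hV ▸ h)
      refine ⟨q + 1, by simpa using hq, ?_, ?_, ?_, ?_⟩
      · simpa using h1
      · intro y hy
        rw [filter_ne_zero_cons_zero] at hy
        simpa using h2 y hy
      · intro z hz
        rw [negTake_drop_succ_cons, neg_zero, filter_ne_zero_cons_zero] at hz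
        simpa using h3 z hz
      · rw [hV, negTake_drop_succ_cons, neg_zero, h4, signVar_eq_signVarAux_filter,
          signVar_eq_signVarAux_filter (0 :: _), filter_ne_zero_cons_zero]
    · cases hF : l.filter (fun a => decide (a ≠ 0)) with
      | nil =>
        exfalso
        apply h
        rw [signVar_eq_signVarAux_filter, filter_ne_zero_cons_of_ne hx, hF, signVarAux_singleton]
      | cons y R =>
        have hy0 : y ≠ 0 := by
          have hmem : y ∈ l.filter (fun a => decide (a ≠ 0)) := by rw [hF]; simp
          simpa using (List.mem_filter.1 hmem).2
        rcases lt_or_gt_of_ne (mul_ne_zero hx hy0) with hxy | hxy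
        · -- the first sign change is at the head: `q = 0`
          refine ⟨0, by simp, ?_, ?_, ?_, ?_⟩
          · simpa using hx
          · intro y' hy'
            rw [filter_ne_zero_cons_of_ne hx] at hy'
            simp only [List.head?_cons, Option.some.injEq] at hy'
            subst hy'
            simpa using mul_self_pos.2 hx
          · intro z hz
            rw [negTake_drop_zero_cons, hF] at hz
            simp only [List.head?_cons, Option.some.injEq] at hz
            subst hz
            simpa [mul_comm] using hxy
          · rw [negTake_drop_zero_cons, signVar_eq_signVarAux_filter, signVar_eq_signVarAux_filter l,
              filter_ne_zero_cons_of_ne hx, hF, signVarAux_cons_cons, if_pos hxy]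
        · -- the head has the sign of the next nonzero entry: recurse on the tail
          have hV : signVar (x :: l) = signVar l := by
            rw [signVar_eq_signVarAux_filter, signVar_eq_signVarAux_filter l,
              filter_ne_zero_cons_of_ne hx, hF, signVarAux_cons_cons, if_neg (not_lt.2 hxy.le),
              zero_add]
          obtain ⟨q, hq, h1, h2, h3, h4⟩ := ih (hV ▸ h)
          have hyc : 0 < y * l[q] := h2 y (by rw [hF]; rfl)
          have hxc : 0 < x * l[q] := by
            by_contra hnot
            have h5 : x * l[q] * (y * y) ≤ 0 :=
              mul_nonpos_of_nonpos_of_nonneg (not_lt.1 hnot) (mul_self_nonneg y)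
            have h6 : 0 < x * y * (y * l[q]) := mul_pos hxy hyc
            nlinarith
          refine ⟨q + 1, by simpa using hq, ?_, ?_, ?_, ?_⟩
          · simpa using h1
          · intro y' hy'
            rw [filter_ne_zero_cons_of_ne hx] at hy'
            simp only [List.head?_cons, Option.some.injEq] at hy'
            subst hy'
            simpa using hxc
          · intro z hz
            rw [negTake_drop_succ_cons, filter_ne_zero_cons_of_ne (neg_ne_zero.2 hx)] at hz
            simp only [List.head?_cons, Option.some.injEq] at hz
            subst hz
            simp only [List.getElem_cons_succ, neg_mul]
            exact neg_lt_zero.2 hxc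
          · rw [hV, h4, negTake_drop_succ_cons, signVar_eq_signVarAux_filter ((-x) :: _),
              filter_ne_zero_cons_of_ne (neg_ne_zero.2 hx),
              signVar_eq_signVarAux_filter ((l.take q).map _ ++ _)]
            cases hM : ((l.take q).map (fun c => -c) ++ l.drop (q + 1)).filter
                (fun a => decide (a ≠ 0)) with
            | nil => rw [signVarAux_singleton, signVarAux_nil']
            | cons z R' =>
              have hz : z * l[q] < 0 := h3 z (by rw [hM]; rfl)
              have hxz : ¬ (-x * z < 0) := by
                intro hlt
                have h7 : z * l[q] * (x * l[q]) < 0 := mul_neg_of_neg_of_pos hz hxc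
                have h8 : 0 < x * z := by linarith [neg_mul x z]
                have h9 : 0 < x * z * (l[q] * l[q]) :=
                  mul_pos h8 (mul_self_pos.2 h1)
                nlinarith
              rw [signVarAux_cons_cons, if_neg hxz, zero_add]

/-- **BD 2017, Lemma 4.4 — DISCHARGED** (`theorem BD2017_lem_4_4_holds : BD2017_lem_4_4`): for a
sequence of reals with nonzero sign variation, `sgnvar(s) = min_q s_q`.
[cite: BihanDickenstein2017, Lemma 4.4] -/
theorem BD2017_lem_4_4_holds : BD2017_lem_4_4 := by
  intro l hl
  refine ⟨fun q hq => signVar_le_one_add_signVar_negTake_drop l q hq, ?_⟩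
  obtain ⟨q, hq, -, -, -, h⟩ := exists_signVar_eq_one_add_signVar_negTake_drop l hl
  exact ⟨q, hq, h⟩

end LemmaFourFour

/-! ### Cor. 3.4 from Thm. 3.3 (proved reduction): a simplex plus an interior point has `σ = 1` -/

section CorThreeFour

variable {n : ℕ}

/-- **Eq. (2.1): `λ` is an affine relation**, `∑_ℓ λ_ℓ w_ℓ = 0`, `∑_ℓ λ_ℓ = 0`, i.e. `A λ = 0` for the
signed maximal minors `λ_ℓ = (−1)^{ℓ+1} det A(ℓ)` (Laplace expansion, along the new row, of `A`
with one of its rows repeated on top). [cite: BihanDickenstein2017, §2.1 eq. (2.1)] -/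
theorem BD17.expMatrix_mulVec_affRel (w : Fin (n + 2) → Fin n → ℤ) :
    (BD17.expMatrix w).mulVec (BD17.affRel w) = 0 := by
  funext i
  set A := BD17.expMatrix w with hA
  let B : Matrix (Fin (n + 2)) (Fin (n + 2)) ℤ := Matrix.of (Fin.cons (A i) A)
  have hB0 : B.det = 0 := by
    refine Matrix.det_zero_of_row_eq (i := 0) (j := i.succ) (Fin.succ_ne_zero i).symm ?_
    funext j
    simp [B]
  have hL := Matrix.det_succ_row_zero B
  have hsub : ∀ j : Fin (n + 2), B.submatrix Fin.succ j.succAbove = A.submatrix id j.succAbove := by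
    intro j
    ext a b
    simp [B, Matrix.submatrix]
  simp only [hsub] at hL
  have hB0j : ∀ j : Fin (n + 2), B 0 j = A i j := fun j => by simp [B]
  simp only [hB0j] at hL
  rw [hB0] at hL
  simp only [Matrix.mulVec, dotProduct, BD17.affRel, Pi.zero_apply]
  have : ∑ j : Fin (n + 2), A i j * ((-1) ^ (j.val + 1) * (A.submatrix id j.succAbove).det) =
      -∑ j : Fin (n + 2), (-1) ^ (j : ℕ) * A i j * (A.submatrix id j.succAbove).det := by
    rw [← Finset.sum_neg_distrib]
    refine Finset.sum_congr rfl fun j _ => ?_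
    ring
  rw [this, ← hL, neg_zero]

/-- Eq. (2.1) over `ℝ`: `A λ = 0` for the real matrix `A` of (1.3). [cite: BihanDickenstein2017, §2.1 eq. (2.1)] -/
theorem BD17.expMatrix_real_mulVec_affRel (w : Fin (n + 2) → Fin n → ℤ) :
    ((BD17.expMatrix w).map (Int.cast : ℤ → ℝ)).mulVec (fun j => (BD17.affRel w j : ℝ)) = 0 := by
  funext i
  have hi := RingHom.map_mulVec (Int.castRingHom ℝ) (BD17.expMatrix w) (BD17.affRel w) i
  rw [BD17.expMatrix_mulVec_affRel, Pi.zero_apply, map_zero] at hi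
  have e1 : ((BD17.expMatrix w).map (Int.cast : ℤ → ℝ)) =
      (BD17.expMatrix w).map (Int.castRingHom ℝ) := by
    ext; simp
  have e2 : (fun j => (BD17.affRel w j : ℝ)) = (Int.castRingHom ℝ) ∘ BD17.affRel w := by
    ext; simp
  rw [Pi.zero_apply, e1, e2]
  exact hi.symm

/-- **"The kernel of the matrix `A` has dimension `1` and can be generated by `λ`"** (p0004:L30; for a
circuit under (1.3)): every real affine relation `μ` (`A μ = 0`) is a multiple of `λ` (rank–nullity).
[cite: BihanDickenstein2017, §2.1 (before eq. (2.1))] -/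
theorem BD17.exists_smul_affRel_of_mulVec_eq_zero (w : Fin (n + 2) → Fin n → ℤ)
    (C : Matrix (Fin n) (Fin (n + 2)) ℝ) (hrk : BD17.RankCond w C) (hcirc : BD17.IsCircuit w)
    (μ : Fin (n + 2) → ℝ) (hμ : ((BD17.expMatrix w).map (Int.cast : ℤ → ℝ)).mulVec μ = 0) :
    ∃ c : ℝ, c • (fun j => (BD17.affRel w j : ℝ)) = μ := by
  set Aℝ := (BD17.expMatrix w).map (Int.cast : ℤ → ℝ) with hAℝ
  set f := Matrix.mulVecLin Aℝ with hf
  have hrange : Module.finrank ℝ (LinearMap.range f) = n + 1 := hrk.1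
  have hsum := LinearMap.finrank_range_add_finrank_ker f
  rw [hrange, Module.finrank_fin_fun] at hsum
  have hker : Module.finrank ℝ (LinearMap.ker f) = 1 := by omega
  set lam : Fin (n + 2) → ℝ := fun j => (BD17.affRel w j : ℝ) with hlam
  have hlam_mem : lam ∈ LinearMap.ker f := by
    rw [LinearMap.mem_ker, hf, Matrix.mulVecLin_apply]
    exact BD17.expMatrix_real_mulVec_affRel w
  have hlam0 : (⟨lam, hlam_mem⟩ : LinearMap.ker f) ≠ 0 := by
    intro h0
    have := congrArg (fun v : LinearMap.ker f => (v : Fin (n + 2) → ℝ) 0) h0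
    simp only [ZeroMemClass.coe_zero, Pi.zero_apply, hlam] at this
    exact hcirc 0 (by exact_mod_cast this)
  have hμ_mem : μ ∈ LinearMap.ker f := by
    rw [LinearMap.mem_ker, hf, Matrix.mulVecLin_apply]
    exact hμ
  obtain ⟨c, hc⟩ := (finrank_eq_one_iff_of_nonzero' _ hlam0).1 hker ⟨μ, hμ_mem⟩
  refine ⟨c, ?_⟩
  have := congrArg Subtype.val hc
  simpa using this

/-- **The signature of a simplex plus an interior point, the relation**: if `w_ℓ` lies in the
interior of the simplex on the other (affinely independent) points, its barycentric coordinates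
`β_j > 0` give the real affine relation `μ = (β, −1 at ℓ)`, `A μ = 0` (proof of Cor. 3.4: "its
signature equals `{1, n+1}`"). [cite: BihanDickenstein2017, Cor. 3.4 (proof)] -/
theorem BD17.exists_affRel_of_interior (w : Fin (n + 2) → Fin n → ℤ) (ℓ : Fin (n + 2))
    (hind : AffineIndependent ℝ (fun j : {j : Fin (n + 2) // j ≠ ℓ} => BD17.realPt w j.1))
    (hint : BD17.realPt w ℓ ∈ interior (convexHull ℝ
      (Set.range fun j : {j : Fin (n + 2) // j ≠ ℓ} => BD17.realPt w j.1))) :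
    ∃ μ : Fin (n + 2) → ℝ, μ ℓ = -1 ∧ (∀ j, j ≠ ℓ → 0 < μ j) ∧
      ((BD17.expMatrix w).map (Int.cast : ℤ → ℝ)).mulVec μ = 0 := by
  classical
  have hcard : Fintype.card {j : Fin (n + 2) // j ≠ ℓ} = Module.finrank ℝ (Fin n → ℝ) + 1 := by
    rw [Module.finrank_fin_fun, Fintype.card_subtype_compl, Fintype.card_fin,
      Fintype.card_subtype_eq]
    omega
  have htot := hind.affineSpan_eq_top_iff_card_eq_finrank_add_one.2 hcard
  let b : AffineBasis {j : Fin (n + 2) // j ≠ ℓ} ℝ (Fin n → ℝ) := ⟨_, hind, htot⟩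
  have hrange : (Set.range fun j : {j : Fin (n + 2) // j ≠ ℓ} => BD17.realPt w j.1) =
      Set.range b := rfl
  rw [hrange, AffineBasis.interior_convexHull] at hint
  set x := BD17.realPt w ℓ with hx
  have hβ1 : ∑ i, b.coord i x = 1 := b.sum_coord_apply_eq_one x
  have hβx : ∑ i, b.coord i x • (b i) = x := b.linear_combination_coord_eq_self x
  refine ⟨fun j => if h : j = ℓ then -1 else b.coord ⟨j, h⟩ x, by simp, ?_, ?_⟩
  · intro j hj
    dsimp only
    rw [dif_neg hj]
    exact hint ⟨j, hj⟩
  · funext r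
    simp only [Pi.zero_apply, Matrix.mulVec, dotProduct]
    rw [Fintype.sum_eq_add_sum_compl ℓ,
      Finset.sum_subtype (p := fun j => j ≠ ℓ) ({ℓ}ᶜ) (by intro j; simp)]
    rw [dif_pos rfl]
    have hsub : ∀ i : {j : Fin (n + 2) // j ≠ ℓ},
        (if h : (i : Fin (n + 2)) = ℓ then (-1 : ℝ) else b.coord ⟨i, h⟩ x) = b.coord i x := by
      intro i
      rw [dif_neg i.2]
    simp only [hsub, Matrix.map_apply, BD17.expMatrix, Matrix.of_apply]
    refine Fin.cases ?_ (fun k => ?_) r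
    · simp only [Fin.cons_zero, Int.cast_one, one_mul]
      rw [hβ1]
      ring
    · simp only [Fin.cons_succ]
      have hk := congrFun hβx k
      simp only [Finset.sum_apply, Pi.smul_apply, smul_eq_mul] at hk
      have hbk : ∀ i : {j : Fin (n + 2) // j ≠ ℓ}, b i k = (w i.1 k : ℝ) := fun i => rfl
      simp only [hbk] at hk
      have hxk : x k = (w ℓ k : ℝ) := rfl
      rw [hxk] at hk
      have : ∑ i : {j : Fin (n + 2) // j ≠ ℓ}, (w i.1 k : ℝ) * b.coord i x =
          ∑ i : {j : Fin (n + 2) // j ≠ ℓ}, b.coord i x * (w i.1 k : ℝ) :=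
        Finset.sum_congr rfl fun i _ => mul_comm _ _
      rw [this, hk]
      ring

/-- **The signature of a simplex plus an interior point**: `σ(𝒜) ≤ 1` (print, proof of Cor. 3.4: "its
signature equals `{1, n+1}` and so `σ(𝒜) = 1`"): `λ = c·μ` with `μ` as above, so all `λ_j`, `j ≠ ℓ`,
have one sign and `λ_ℓ` the other. [cite: BihanDickenstein2017, Cor. 3.4 (proof)] -/
theorem BD17.sigma_le_one_of_interior (w : Fin (n + 2) → Fin n → ℤ)
    (C : Matrix (Fin n) (Fin (n + 2)) ℝ) (hrk : BD17.RankCond w C) (hcirc : BD17.IsCircuit w)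
    (ℓ : Fin (n + 2))
    (hind : AffineIndependent ℝ (fun j : {j : Fin (n + 2) // j ≠ ℓ} => BD17.realPt w j.1))
    (hint : BD17.realPt w ℓ ∈ interior (convexHull ℝ
      (Set.range fun j : {j : Fin (n + 2) // j ≠ ℓ} => BD17.realPt w j.1))) :
    BD17.sigma w ≤ 1 := by
  obtain ⟨μ, hμℓ, hμpos, hμker⟩ := BD17.exists_affRel_of_interior w ℓ hind hint
  obtain ⟨c, hc⟩ := BD17.exists_smul_affRel_of_mulVec_eq_zero w C hrk hcirc μ hμker
  have hcj : ∀ j, c * (BD17.affRel w j : ℝ) = μ j := fun j => by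
    have := congrFun hc j
    simpa using this
  have hcℓ : c * (BD17.affRel w ℓ : ℝ) = -1 := by rw [hcj ℓ, hμℓ]
  rcases lt_trichotomy c 0 with hc0 | hc0 | hc0
  · -- `c < 0`: `λ_ℓ > 0` and `λ_j < 0` for `j ≠ ℓ`, so `a₊ = 1`
    have hpos : BD17.sigPos w = 1 := by
      unfold BD17.sigPos
      rw [Finset.card_eq_one]
      refine ⟨ℓ, ?_⟩
      ext j
      simp only [Finset.mem_filter, Finset.mem_univ, true_and, Finset.mem_singleton]
      constructor
      · intro hj
        by_contra hne
        have h1 := hcj j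
        have h2 := hμpos j hne
        have h3 : (0 : ℝ) < (BD17.affRel w j : ℝ) := by exact_mod_cast hj
        nlinarith
      · rintro rfl
        have h3 : (0 : ℝ) < (BD17.affRel w j : ℝ) := by
          by_contra hle
          push Not at hle
          nlinarith [mul_nonneg_of_nonpos_of_nonpos hc0.le hle]
        exact_mod_cast h3
    unfold BD17.sigma
    rw [hpos]
    exact min_le_left _ _
  · exfalso
    rw [hc0, zero_mul] at hcℓ
    norm_num at hcℓ
  · -- `c > 0`: `λ_ℓ < 0` and `λ_j > 0` for `j ≠ ℓ`, so `a₋ = 1`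
    have hneg : BD17.sigNeg w = 1 := by
      unfold BD17.sigNeg
      rw [Finset.card_eq_one]
      refine ⟨ℓ, ?_⟩
      ext j
      simp only [Finset.mem_filter, Finset.mem_univ, true_and, Finset.mem_singleton]
      constructor
      · intro hj
        by_contra hne
        have h1 := hcj j
        have h2 := hμpos j hne
        have h3 : (BD17.affRel w j : ℝ) < 0 := by exact_mod_cast hj
        nlinarith
      · rintro rfl
        have h3 : (BD17.affRel w j : ℝ) < 0 := by
          by_contra hle
          push Not at hle
          nlinarith [mul_nonneg hc0.le hle]
        exact_mod_cast h3
    unfold BD17.sigma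
    rw [hneg]
    exact min_le_right _ _

/-- **BD 2017, Cor. 3.4 follows from Thm. 3.3** ("Theorem 3.3 ensures that `n_𝒜(C) ≤ 2`",
p0009:L99): for a simplex plus an interior point `σ(𝒜) ≤ 1`, so both branches `2σ`, `2σ − 1` of the
bound (3.2) are `≤ 2`. [cite: BihanDickenstein2017, Cor. 3.4] -/
theorem BD2017_cor_3_4_of_thm_3_3 (h33 : BD2017_thm_3_3) : BD2017_cor_3_4 := by
  intro n w C hrk hcone hcirc hfin hgeom
  obtain ⟨ℓ, hind, hint⟩ := hgeom
  have hσ := BD17.sigma_le_one_of_interior w C hrk hcirc ℓ hind hint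
  have h := (h33 n w C hrk hcone hcirc hfin).1
  split_ifs at h <;> omega

end CorThreeFour

end Literature.Computability.AlgebraicComplexity
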